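import Mathlib
import Summits.ValiantsHypothesis.ValiantsHypothesis.Theorems.DivisionGapDefs
import Summits.ValiantsHypothesis.ValiantsHypothesis.Theorems.DivisionGapPerCofactorDegreeReductionStubGadgetProjection
import Literature.Computability.AlgebraicComplexity.ValiantClassesProofs
import Literature.Computability.AlgebraicComplexity.PermanentIrreducible

/-!
# `DivisionGap.PerCofactorDegreeReduction` (stmt-ValiantsHypothesis-15046), line `Sketch_ideator4`
(idea intrinsic-member-descent): the BLOCK PROJECTION (stub `stub_blockProjection`, L)

Cells are `(row, col)`; a permutation `σ : Equiv.Perm (Fin n)` is the perfect matching with cells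
`(σ i, i)`, and `facePer A` is the perfect-matching polynomial of the cell set `A`.  The host `A`
contains the FULL BLOCK `er(Fin m) × ec(Fin m)` (block rows `er a`, block columns `ec b`, both
injective), and every column `j` off the range of `ec` is matched to a row `M₀ j` off the range of
`er` by a cell `(M₀ j, j) ∈ A`, injectively in `j`.  The substitution `x_{(er a, ec b)} ↦ X_{(a, b)}`,
`x_{(M₀ j, j)} ↦ 1` (`j` off the range of `ec`), every other variable `↦ 0`, is a Valiant projection
(free, `complexity_le_of_isProjection`) sending `per_A` to `per_m`: a matching of `A` survives iff
all its cells are designated; the survivors are exactly the LIFTS `σ_g` of the permutations `g` of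
`Fin m` (`ec b ↦ er (g b)`, `j ↦ M₀ j` off the range of `ec`), and `σ_g ↦ ∏_b X_{(g b, b)} = x^{μ_g}`.
This is the one-edge case of the gadget projection `GadgetProjection.stub_gadgetProjection` (F2).
No definitions: the substitution and the lifts enter the lemmas as parameters characterised by
hypotheses. [folklore]
-/

noncomputable section

-- `Summit.ValiantsHypothesis.ValiantsHypothesis.…` is the tree's mandated single-conjunct layout
-- (Sub = Summit), so the duplicated namespace component is intended.
set_option linter.dupNamespace false

open MvPolynomial Literature.Computability.AlgebraicComplexity
open Summit.ValiantsHypothesis.ValiantsHypothesis.Theorems.DivisionGapPerDivisionHard (facePer)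
open Summit.ValiantsHypothesis.ValiantsHypothesis.Theorems.DivisionGap.PerCofactorDegreeReduction.GadgetProjection
  (monomial_permMonomial_eq_prod)
open scoped NNReal

namespace Summit.ValiantsHypothesis.ValiantsHypothesis.Theorems.DivisionGap.PerCofactorDegreeReduction.BlockProjection

variable {n m : ℕ} {A : Finset (Fin n × Fin n)} {er ec : Fin m → Fin n} {M₀ : Fin n → Fin n}

/-- Every column is a block column `ec b` or lies off the range of `ec`. [folklore] -/
theorem col_cases (ec : Fin m → Fin n) (j : Fin n) : (∃ b, j = ec b) ∨ (∀ b, ec b ≠ j) :=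
  or_iff_not_imp_left.2 fun h b hb => h ⟨b, hb.symm⟩

/-! ### The block substitution -/

/-- **The block substitution exists** and is a Valiant projection:
`x_{(er a, ec b)} ↦ X_{(a, b)}`, the matching cells `(M₀ j, j)` of the columns `j` off the range of
`ec` `↦ 1`, everything else `↦ 0`; a variable with nonzero image sits on a designated cell.
[folklore] -/
theorem exists_subst (her : Function.Injective er) (hec : Function.Injective ec) :
    ∃ φ : Fin n × Fin n → MvPolynomial (Fin m × Fin m) ℝ≥0,
      (∀ e, (∃ j, φ e = X j) ∨ ∃ c, φ e = C c) ∧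
      (∀ a b, φ (er a, ec b) = X (a, b)) ∧
      (∀ j, (∀ b, ec b ≠ j) → φ (M₀ j, j) = 1) ∧
      (∀ r c, φ (r, c) ≠ 0 →
        (∃ a b, c = ec b ∧ r = er a) ∨ ((∀ b, ec b ≠ c) ∧ r = M₀ c)) := by
  classical
  -- the cells sent to `1`
  let U : Fin n × Fin n → Prop := fun e => ∃ j, (∀ b, ec b ≠ j) ∧ e = (M₀ j, j)
  refine ⟨fun e => if h : ∃ p : Fin m × Fin m, e = (er p.1, ec p.2) then X h.choose
      else if U e then 1 else 0,
    fun e => ?_, fun a b => ?_, fun j hj => ?_, fun r c hne => ?_⟩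
  · by_cases h : ∃ p : Fin m × Fin m, e = (er p.1, ec p.2)
    · exact Or.inl ⟨h.choose, by simp only [dif_pos h]⟩
    · by_cases hU : U e
      · exact Or.inr ⟨1, by simp only [dif_neg h, if_pos hU, C_1]⟩
      · exact Or.inr ⟨0, by simp only [dif_neg h, if_neg hU, C_0]⟩
  · have h : ∃ p : Fin m × Fin m, (er a, ec b) = (er p.1, ec p.2) := ⟨(a, b), rfl⟩
    have hp : h.choose = (a, b) := by
      obtain ⟨h1, h2⟩ := Prod.mk.inj h.choose_spec
      exact Prod.ext (her h1).symm (hec h2).symm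
    simp only [dif_pos h, hp]
  · have h : ¬ ∃ p : Fin m × Fin m, (M₀ j, j) = (er p.1, ec p.2) :=
      fun ⟨p, hp⟩ => hj p.2 (Prod.mk.inj hp).2.symm
    have hU : U (M₀ j, j) := ⟨j, hj, rfl⟩
    simp only [dif_neg h, if_pos hU]
  · by_cases h : ∃ p : Fin m × Fin m, (r, c) = (er p.1, ec p.2)
    · obtain ⟨p, hp⟩ := h
      obtain ⟨h1, h2⟩ := Prod.mk.inj hp
      exact Or.inl ⟨p.1, p.2, h2, h1⟩
    · by_cases hU : U (r, c)
      · obtain ⟨j, hj, hq⟩ := hU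
        obtain ⟨h1, h2⟩ := Prod.mk.inj hq
        subst h2
        exact Or.inr ⟨hj, h1⟩
      · exfalso
        apply hne
        simp only [dif_neg h, if_neg hU]

/-! ### Lifts of the permutations of `Fin m` -/

/-- **The lift `σ_g` of a permutation `g` of `Fin m` exists**: the lift function
(`ec b ↦ er (g b)`, `j ↦ M₀ j` off the range of `ec`) is injective — `er ∘ g` is injective, `M₀`
is injective off the range of `ec`, and `er a ≠ M₀ j` there — hence a permutation of `Fin n`.
[folklore] -/
theorem exists_lift (her : Function.Injective er) (hec : Function.Injective ec)
    (hM : ∀ j, (∀ b, ec b ≠ j) → ∀ a, er a ≠ M₀ j)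
    (hMinj : ∀ j j', (∀ b, ec b ≠ j) → (∀ b, ec b ≠ j') → M₀ j = M₀ j' → j = j')
    (g : Equiv.Perm (Fin m)) :
    ∃ σ : Equiv.Perm (Fin n), (∀ b, σ (ec b) = er (g b)) ∧
      (∀ j, (∀ b, ec b ≠ j) → σ j = M₀ j) := by
  classical
  -- the lift FUNCTION `f` and its values on the two kinds of columns
  obtain ⟨f, f1, f2⟩ : ∃ f : Fin n → Fin n, (∀ b, f (ec b) = er (g b)) ∧
      (∀ j, (∀ b, ec b ≠ j) → f j = M₀ j) := by
    refine ⟨fun i => if h : ∃ b, ec b = i then er (g h.choose) else M₀ i, fun b => ?_,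
      fun j hj => ?_⟩
    · have h : ∃ b', ec b' = ec b := ⟨b, rfl⟩
      have hb : h.choose = b := hec h.choose_spec
      simp only [dif_pos h, hb]
    · have h : ¬ ∃ b, ec b = j := fun ⟨b, hb⟩ => hj b hb
      simp only [dif_neg h]
  suffices hinj : Function.Injective f from
    ⟨Equiv.ofBijective f hinj.bijective_of_finite, f1, f2⟩
  intro i j hij
  rcases col_cases ec i with ⟨b, rfl⟩ | hi
  · rw [f1] at hij
    rcases col_cases ec j with ⟨b', rfl⟩ | hj
    · rw [f1] at hij
      rw [g.injective (her hij)]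
    · rw [f2 j hj] at hij
      exact absurd hij (hM j hj _)
  · rw [f2 i hi] at hij
    rcases col_cases ec j with ⟨b', rfl⟩ | hj
    · rw [f1] at hij
      exact absurd hij.symm (hM i hi _)
    · rw [f2 j hj] at hij
      exact hMinj i j hi hj hij

/-! ### The survivors are the lifts -/

/-- **A designated matching is a lift.**  If the matching `σ` sends every block column `ec b` to
a block row `er (g b)`, then `g` is injective (`σ` and `ec` are), hence a permutation of `Fin m`.
[folklore] -/
theorem exists_perm_of_designated (hec : Function.Injective ec)
    {σ : Equiv.Perm (Fin n)} (hD : ∀ b, ∃ a, σ (ec b) = er a) :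
    ∃ g : Equiv.Perm (Fin m), ∀ b, σ (ec b) = er (g b) := by
  choose g hg using hD
  have hinj : Function.Injective g := fun b b' h =>
    hec (σ.injective (by rw [hg, hg, h]))
  exact ⟨Equiv.ofBijective g hinj.bijective_of_finite, hg⟩

/-! ### The image of the face permanent -/

/-- **The block substitution sends `per_A` to `per_m`.**  The lifts `σ_g` are matchings of `A`
sent to `x^{μ_g}` (the only non-unit factors sit on the block columns), `g ↦ σ_g` is injective,
and a matching of `A` with nonzero image is designated, hence a lift
(`exists_perm_of_designated`; two lifts of the same `g` agree column by column). [folklore] -/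
theorem aeval_facePer_eq_perPoly (her : Function.Injective er) (hec : Function.Injective ec)
    (hA : ∀ a b, (er a, ec b) ∈ A)
    (hM₀ : ∀ j, (∀ b, ec b ≠ j) → (M₀ j, j) ∈ A ∧ ∀ a, er a ≠ M₀ j)
    (hMinj : ∀ j j', (∀ b, ec b ≠ j) → (∀ b, ec b ≠ j') → M₀ j = M₀ j' → j = j')
    {φ : Fin n × Fin n → MvPolynomial (Fin m × Fin m) ℝ≥0}
    (hφX : ∀ a b, φ (er a, ec b) = X (a, b)) (hφ1 : ∀ j, (∀ b, ec b ≠ j) → φ (M₀ j, j) = 1)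
    (hφ0 : ∀ r c, φ (r, c) ≠ 0 →
      (∃ a b, c = ec b ∧ r = er a) ∨ ((∀ b, ec b ≠ c) ∧ r = M₀ c)) :
    aeval φ (facePer A) = perPoly (Fin m) ℝ≥0 := by
  classical
  choose lift h1 h2 using exists_lift her hec (fun j hj => (hM₀ j hj).2) hMinj
  have hinj : Function.Injective lift := fun g g' h =>
    Equiv.ext fun b => her ((h1 g b).symm.trans (by rw [h, h1]))
  rw [facePer, map_sum, perPoly_eq_sum_monomial]
  simp_rw [monomial_permMonomial_eq_prod, map_prod, aeval_X]
  -- the lifts are sent to the permutation monomials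
  have hR : ∑ g : Equiv.Perm (Fin m), ∏ i, (X (g i, i) : MvPolynomial (Fin m × Fin m) ℝ≥0) =
      ∑ σ ∈ Finset.univ.image lift, ∏ i, φ (σ i, i) := by
    rw [Finset.sum_image fun g _ g' _ h => hinj h]
    refine Finset.sum_congr rfl fun g _ => ?_
    symm
    rw [← Finset.prod_subset (Finset.subset_univ (Finset.univ.image ec)),
      Finset.prod_image fun b₁ _ b₂ _ h => hec h]
    · refine Finset.prod_congr rfl fun b _ => ?_
      rw [h1]
      exact hφX (g b) b
    · intro i _ hi
      have hi' : ∀ b, ec b ≠ i := fun b hb =>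
        hi (Finset.mem_image.2 ⟨b, Finset.mem_univ _, hb⟩)
      rw [h2 g i hi']
      exact hφ1 i hi'
  rw [hR]
  symm
  refine Finset.sum_subset (fun σ hσ => ?_) (fun σ _ hσ => ?_)
  · -- a lift is a matching of `A`
    obtain ⟨g, -, rfl⟩ := Finset.mem_image.1 hσ
    refine Finset.mem_filter.2 ⟨Finset.mem_univ _, fun i => ?_⟩
    rcases col_cases ec i with ⟨b, rfl⟩ | hi
    · rw [h1]
      exact hA _ _
    · rw [h2 g i hi]
      exact (hM₀ i hi).1
  · -- a matching of `A` with nonzero image is designated, hence a lift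
    by_contra hne
    have hz : ∀ i, φ (σ i, i) ≠ 0 := fun i h0 => hne (Finset.prod_eq_zero (Finset.mem_univ i) h0)
    have hD : ∀ b, ∃ a, σ (ec b) = er a := fun b => by
      rcases hφ0 _ _ (hz (ec b)) with ⟨a, b', _, h⟩ | ⟨h, _⟩
      · exact ⟨a, h⟩
      · exact absurd rfl (h b)
    have hD' : ∀ j, (∀ b, ec b ≠ j) → σ j = M₀ j := fun j hj => by
      rcases hφ0 _ _ (hz j) with ⟨a, b, hb, _⟩ | ⟨_, h⟩
      · exact absurd hb.symm (hj b)
      · exact h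
    obtain ⟨g, hg⟩ := exists_perm_of_designated hec hD
    refine hσ (Finset.mem_image.2 ⟨g, Finset.mem_univ _, Equiv.ext fun i => ?_⟩)
    rcases col_cases ec i with ⟨b, rfl⟩ | hi
    · rw [h1, hg]
    · rw [h2 g i hi, hD' i hi]

/-! ### The stub -/

/-- **Block projection (stub `stub_blockProjection`, L, of line `Sketch_ideator4`).**  If the cell
set `A` contains the full block `er(Fin m) × ec(Fin m)` and a matching `j ↦ (M₀ j, j)` of the
columns off `ec` into rows off `er`, injective on those columns, then `L⁺(per_m) ≤ L⁺(per_A)`: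
the block substitution (`exists_subst`) is a Valiant projection (`complexity_le_of_isProjection`)
sending `per_A` to `per_m` (`aeval_facePer_eq_perPoly`). [folklore] -/
theorem stub_blockProjection :
    ∀ (n m : ℕ) (A : Finset (Fin n × Fin n)) (er ec : Fin m → Fin n) (M₀ : Fin n → Fin n),
      Function.Injective er → Function.Injective ec →
      (∀ a b, (er a, ec b) ∈ A) →
      (∀ j, (∀ b, ec b ≠ j) → (M₀ j, j) ∈ A ∧ ∀ a, er a ≠ M₀ j) →
      (∀ j j', (∀ b, ec b ≠ j) → (∀ b, ec b ≠ j') → M₀ j = M₀ j' → j = j') →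
      complexity (perPoly (Fin m) ℝ≥0) ≤ complexity (facePer A) := by
  intro n m A er ec M₀ her hec hA hM₀ hMinj
  obtain ⟨φ, hproj, hφX, hφ1, hφ0⟩ := exists_subst (M₀ := M₀) her hec
  exact complexity_le_of_isProjection ⟨φ, hproj,
    (aeval_facePer_eq_perPoly her hec hA hM₀ hMinj hφX hφ1 hφ0).symm⟩

end Summit.ValiantsHypothesis.ValiantsHypothesis.Theorems.DivisionGap.PerCofactorDegreeReduction.BlockProjection

end
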